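import Summits.RiemannHypothesis.RiemannHypothesis.Theorems.GroundBartaGroundBartaFloorLeakageEnvelope
import Summits.RiemannHypothesis.RiemannHypothesis.Theorems.WeilGroundStateGroundStatesConvergeToXiExpClassHarmonic
import Summits.RiemannHypothesis.RiemannHypothesis.Theorems.WeilGroundStateGroundStatesConvergeToXiStubStrongClassPairing
import Summits.RiemannHypothesis.RiemannHypothesis.Theorems.WeilGroundStateGroundStatesConvergeToXiStubGroundStateEulerLagrangeStrong
import Summits.RiemannHypothesis.RiemannHypothesis.Theorems.WeilGroundStateGroundStatesConvergeToXiEulerLagrange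
import Literature.NumberTheory.LFunctions.WeilOddThetaVector
import Mathlib.Analysis.Calculus.IteratedDeriv.Lemmas
import HarnessLib

/-!
# Harmonic splitting of the Weil pairing against Riemann's kernel
(crux `GroundBarta.GroundBartaFloor`, stmt-RiemannHypothesis-18389; line
`outer_cutoff_harmonic_pairing`, registered stub H `stub_harmonicSplit`)

For a Weil test function `g` and a kernel `κ` of the strong exponential Weil class (smooth, every
derivative `O(e^{-|t|})`),

  `W(g ⋆ (Φ - κ)~) = -W(g ⋆ κ̃)`,   `Φ = weilThetaPhi` (`Φ̂ = ξ`).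

Ingredients, all in the tree and RH-free:
* `W(g ⋆ Φ̃) = conj W(Φ ⋆ g̃) = 0` — Riemann's kernel is WEIL-HARMONIC (`phi_conv_harmonic`:
  `Φ̂ = ξ` vanishes at every non-trivial zero, on the line or not) and the polarised functional is
  hermitian with no hypotheses (`weilFunctional_weilConv_weilReflect_swap`);
* `W` is ADDITIVE on the exponential Weil class (`weilFunctional_sub_expClass` below): by the class
  explicit formula `W(F) = Σ'_ρ m(ρ) F̂(ρ)` (`explicit_formula_expClass`, absolutely convergent) and
  linearity of `F ↦ F̂(ρ)` in the critical strip;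
* `g ⋆ Φ̃`, `g ⋆ κ̃` lie in the class (`stub_strongClass_pairing`, `stub_phi_iteratedDeriv_envelope`).
Elementary given these; no published source needed beyond Bombieri 2000 (explicit formula).
[folklore]
-/

set_option linter.dupNamespace false

noncomputable section

open Set MeasureTheory Filter Complex
open scoped Real Topology ComplexConjugate

namespace Summit.RiemannHypothesis.RiemannHypothesis.Theorems.GroundBartaFloor

open Literature.NumberTheory.LFunctions
open Summit.RiemannHypothesis.RiemannHypothesis.Theorems.GroundStatesConvergeToXi

/-! ## The exponential class: from all-orders envelopes to the `k ≤ 2` form -/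

/-- All-orders envelope of a difference: if every derivative of `F` and of `G` is `O(e^{-b|t|})`,
so is every derivative of `F - G`. [folklore] -/
theorem hsplit_envelope_sub {F G : ℝ → ℂ} {b : ℝ} (hF : ContDiff ℝ (⊤ : ℕ∞) F)
    (hG : ContDiff ℝ (⊤ : ℕ∞) G)
    (hFb : ∀ k : ℕ, ∃ C : ℝ, ∀ t : ℝ, ‖iteratedDeriv k F t‖ ≤ C * Real.exp (-(b * |t|)))
    (hGb : ∀ k : ℕ, ∃ C : ℝ, ∀ t : ℝ, ‖iteratedDeriv k G t‖ ≤ C * Real.exp (-(b * |t|))) :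
    ∀ k : ℕ, ∃ C : ℝ, ∀ t : ℝ,
      ‖iteratedDeriv k (fun t => F t - G t) t‖ ≤ C * Real.exp (-(b * |t|)) := by
  intro k
  obtain ⟨C, hC⟩ := hFb k
  obtain ⟨D, hD⟩ := hGb k
  refine ⟨C + D, fun t => ?_⟩
  have hFk : ContDiffAt ℝ k F t := (hF.of_le (by exact_mod_cast le_top)).contDiffAt
  have hGk : ContDiffAt ℝ k G t := (hG.of_le (by exact_mod_cast le_top)).contDiffAt
  rw [iteratedDeriv_fun_sub hFk hGk]
  calc ‖iteratedDeriv k F t - iteratedDeriv k G t‖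
      ≤ ‖iteratedDeriv k F t‖ + ‖iteratedDeriv k G t‖ := norm_sub_le _ _
    _ ≤ C * Real.exp (-(b * |t|)) + D * Real.exp (-(b * |t|)) := add_le_add (hC t) (hD t)
    _ = (C + D) * Real.exp (-(b * |t|)) := by ring

/-- Linearity of the transform in the closed critical strip on the exponential class:
`(F - G)^(s) = F̂(s) - Ĝ(s)` for `0 ≤ Re s ≤ 1` (both integrands are integrable,
`zsTrunc_integrable_mul_cexp`). [folklore] -/
theorem hsplit_weilMellin_sub {F G : ℝ → ℂ} {C D b₀ : ℝ} (hFc : Continuous F)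
    (hGc : Continuous G) (hb : 1 / 2 < b₀)
    (hF0 : ∀ t, ‖F t‖ ≤ C * Real.exp (-(b₀ * |t|)))
    (hG0 : ∀ t, ‖G t‖ ≤ D * Real.exp (-(b₀ * |t|))) {s : ℂ} (hs0 : 0 ≤ s.re)
    (hs1 : s.re ≤ 1) :
    weilMellin (fun t => F t - G t) s = weilMellin F s - weilMellin G s := by
  unfold weilMellin
  rw [← integral_sub (zsTrunc_integrable_mul_cexp hFc hb hF0 hs0 hs1)
    (zsTrunc_integrable_mul_cexp hGc hb hG0 hs0 hs1)]
  refine integral_congr_ae (Eventually.of_forall fun t => ?_)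
  simp only
  ring

/-- **`W` is additive on the exponential Weil class**: for smooth `F, G` whose derivatives of
every order are `O(e^{-b₀|t|})` with `b₀ > 1/2`, `W(F - G) = W(F) - W(G)`.  Proof: the class
explicit formula `W(H) = Σ'_ρ m(ρ) Ĥ(ρ)` (`explicit_formula_expClass`, absolutely convergent) for
`H = F, G, F - G`, and `(F - G)^(ρ) = F̂(ρ) - Ĝ(ρ)` at every non-trivial zero. [folklore] -/
theorem weilFunctional_sub_expClass {F G : ℝ → ℂ} {b₀ : ℝ} (hF : ContDiff ℝ (⊤ : ℕ∞) F)
    (hG : ContDiff ℝ (⊤ : ℕ∞) G) (hb : 1 / 2 < b₀)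
    (hFb : ∀ k : ℕ, ∃ C : ℝ, ∀ t : ℝ, ‖iteratedDeriv k F t‖ ≤ C * Real.exp (-(b₀ * |t|)))
    (hGb : ∀ k : ℕ, ∃ C : ℝ, ∀ t : ℝ, ‖iteratedDeriv k G t‖ ≤ C * Real.exp (-(b₀ * |t|))) :
    weilFunctional (fun t => F t - G t) = weilFunctional F - weilFunctional G := by
  have hFG : ContDiff ℝ (⊤ : ℕ∞) (fun t => F t - G t) := hF.sub hG
  obtain ⟨C, hF0, hF1, hF2⟩ := hExt_deriv_bounds_of_all hFb
  obtain ⟨D, hG0, hG1, hG2⟩ := hExt_deriv_bounds_of_all hGb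
  obtain ⟨E, hH0, hH1, hH2⟩ := hExt_deriv_bounds_of_all (hsplit_envelope_sub hF hG hFb hGb)
  obtain ⟨hsF, -, -, -, hWF⟩ := explicit_formula_expClass hF hb hF0 hF1 hF2
  obtain ⟨hsG, -, -, -, hWG⟩ := explicit_formula_expClass hG hb hG0 hG1 hG2
  obtain ⟨-, -, -, -, hWH⟩ := explicit_formula_expClass hFG hb hH0 hH1 hH2
  rw [← hWF, ← hWG, ← hWH, ← (hsF.of_norm).tsum_sub (hsG.of_norm)]
  refine tsum_congr fun ρ => ?_
  have h0 := ZetaZeros.riemannZetaNontrivialZeros.re_pos ρ.2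
  have h1 := ZetaZeros.riemannZetaNontrivialZeros.re_lt_one ρ.2
  rw [hsplit_weilMellin_sub hF.continuous hG.continuous hb hF0 hG0 h0.le h1.le]
  ring

/-! ## The pairings `g ⋆ Φ̃`, `g ⋆ κ̃` lie in the class -/

/-- A Weil test function is weighted-`L¹` data for `stub_strongClass_pairing` (rate `1`).
[folklore] -/
theorem hsplit_test_data {g : ℝ → ℂ} (hg : IsWeilTest g) :
    AEStronglyMeasurable g volume ∧ Integrable (fun t : ℝ => ‖g t‖ * Real.exp (1 * |t|)) :=
  ⟨hg.1.continuous.aestronglyMeasurable, integrable_norm_mul_exp_of_isWeilTest hg 1⟩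

/-- For a test `g` and `κ` in the strong class of rate `1`, `g ⋆ κ̃` is smooth with all
derivatives `O(e^{-|t|})` (`stub_strongClass_pairing`). [folklore] -/
theorem hsplit_pairing_class {g κ : ℝ → ℂ} (hg : IsWeilTest g) (hκ : ContDiff ℝ (⊤ : ℕ∞) κ)
    (hκb : ∀ k : ℕ, ∃ C : ℝ, ∀ t : ℝ, ‖iteratedDeriv k κ t‖ ≤ C * Real.exp (-(1 * |t|))) :
    ContDiff ℝ (⊤ : ℕ∞) (weilConv g (weilReflect κ)) ∧
      ∀ k : ℕ, ∃ C : ℝ, ∀ t : ℝ,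
        ‖iteratedDeriv k (weilConv g (weilReflect κ)) t‖ ≤ C * Real.exp (-(1 * |t|)) := by
  obtain ⟨hga, hgi⟩ := hsplit_test_data hg
  obtain ⟨hcd, hbd, -⟩ := stub_strongClass_pairing g κ 1 1 hga (by norm_num) hgi hκ (by norm_num)
    le_rfl hκb
  exact ⟨hcd, hbd⟩

/-! ## Riemann's kernel on the right of the pairing -/

/-- `W(g ⋆ Φ̃) = 0` for every Weil test `g`: hermitian symmetry
(`weilFunctional_weilConv_weilReflect_swap`) and `W(Φ ⋆ g̃) = 0` (`phi_conv_harmonic`).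
[folklore] -/
theorem weilFunctional_weilConv_weilReflect_phi {g : ℝ → ℂ} (hg : IsWeilTest g) :
    weilFunctional (weilConv g (weilReflect fun t : ℝ => ((weilThetaPhi t : ℝ) : ℂ))) = 0 := by
  have hΦ : (fun t : ℝ => ((weilThetaPhi t : ℝ) : ℂ)) =
      fun t : ℝ => (2 : ℂ) * LagariasMontague.Psic (2 * t) := funext leakEnv_ofReal_weilThetaPhi
  rw [hΦ, weilFunctional_weilConv_weilReflect_swap, phi_conv_harmonic hg, map_zero]

/-- Convolution on the right is additive against continuous kernels, for a test `g`:
`g ⋆ (A - B)~ = g ⋆ Ã - g ⋆ B̃` pointwise. [folklore] -/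
theorem hsplit_weilConv_weilReflect_sub {g A B : ℝ → ℂ} (hg : IsWeilTest g) (hA : Continuous A)
    (hB : Continuous B) :
    weilConv g (weilReflect fun t => A t - B t) =
      fun t => weilConv g (weilReflect A) t - weilConv g (weilReflect B) t := by
  funext t
  have hint : ∀ {K : ℝ → ℂ}, Continuous K →
      Integrable (fun u : ℝ => g u * weilReflect K (t - u)) := by
    intro K hK
    have hc : Continuous fun u : ℝ => weilReflect K (t - u) :=
      ((hK.comp continuous_neg).star).comp (continuous_const.sub continuous_id)
    exact (hg.1.continuous.mul hc).integrable_of_hasCompactSupport hg.2.mul_right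
  rw [weilConv_apply, weilConv_apply, weilConv_apply, ← integral_sub (hint hA) (hint hB)]
  refine integral_congr_ae (Eventually.of_forall fun u => ?_)
  simp only [weilReflect, map_sub]
  ring

/-- **Stub H — harmonic splitting.**  For a Weil test `g` and `κ` in the exponential class,
`W(g ⋆ (Φ - κ)~) = -W(g ⋆ κ̃)`: `W(g ⋆ Φ̃) = conj W(Φ ⋆ g̃) = 0` (`phi_conv_harmonic`,
`weilFunctional_weilConv_weilReflect_swap`) and `W` is additive on the exponential class
(`stub_strongClass_pairing`, `explicit_formula_expClass`). [folklore] -/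
theorem stub_harmonicSplit :
    ∀ (g κ : ℝ → ℂ), IsWeilTest g → ContDiff ℝ (⊤ : ℕ∞) κ →
      (∀ k : ℕ, ∃ C : ℝ, ∀ t : ℝ, ‖iteratedDeriv k κ t‖ ≤ C * Real.exp (-(1 * |t|))) →
      weilFunctional (weilConv g (weilReflect fun t => ((weilThetaPhi t : ℝ) : ℂ) - κ t)) =
        -weilFunctional (weilConv g (weilReflect κ)) := by
  intro g κ hg hκ hκb
  have hΦeq : (fun t : ℝ => ((weilThetaPhi t : ℝ) : ℂ)) =
      fun t : ℝ => (2 : ℂ) * LagariasMontague.Psic (2 * t) := funext leakEnv_ofReal_weilThetaPhi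
  have hΦc : ContDiff ℝ (⊤ : ℕ∞) (fun t : ℝ => ((weilThetaPhi t : ℝ) : ℂ)) := by
    rw [hΦeq]; exact contDiff_phi
  have hΦb : ∀ k : ℕ, ∃ C : ℝ, ∀ t : ℝ,
      ‖iteratedDeriv k (fun t : ℝ => ((weilThetaPhi t : ℝ) : ℂ)) t‖ ≤ C * Real.exp (-(1 * |t|)) := by
    rw [hΦeq]; exact stub_phi_iteratedDeriv_envelope
  obtain ⟨hFc, hFb⟩ := hsplit_pairing_class hg hΦc hΦb
  obtain ⟨hGc, hGb⟩ := hsplit_pairing_class hg hκ hκb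
  rw [hsplit_weilConv_weilReflect_sub hg hΦc.continuous hκ.continuous,
    weilFunctional_sub_expClass hFc hGc (by norm_num : (1 : ℝ) / 2 < 1) hFb hGb,
    weilFunctional_weilConv_weilReflect_phi hg, zero_sub]

end Summit.RiemannHypothesis.RiemannHypothesis.Theorems.GroundBartaFloor

end
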